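import Literature.Topology.FourManifolds.SurfaceGroupGeneratorImages
import Mathlib.Tactic.Group
import HarnessLib

/-!
# Handle moves of the surface group `S_g`: inversion, handle slides, and the cut swap

Topic `Literature/Topology/FourManifolds`; sequel to `SurfaceGroupGeneratorImages.lean`
(automorphisms of `SurfaceGroup g = ⟨a₀, b₀, …, a_{g-1}, b_{g-1} ∣ ∏ᵢ [aᵢ, bᵢ]⟩` from generator
images).  Written for the handlebody-realisation theorem (`HandlebodyGroupRealisation.lean`:
every automorphism of `π₁` of a handlebody `S_g ⧸ ⟪a₀, …, a_{g-1}⟫ = F_g` is induced by an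
automorphism of `S_g` preserving the kernel — Griffiths 1964; Zieschang 1964), which lifts
Nielsen's generators of `Aut F_g` (Lyndon–Schupp I.4: `α_k : x_k ↦ x_k⁻¹`, `β_{kl} : x_k ↦ x_k x_l`)
one at a time.  The lifts, as honest automorphisms of `S_g` given by generator images fixing the
surface relator ON THE NOSE:

* `SurfaceGroup.flipEquiv k` — `a_k ↦ b_k a_k⁻¹ b_k⁻¹`, `b_k ↦ b_k a_k b_k⁻²` (identity on the other
  handles): fixes `[a_k, b_k]` and induces the inversion `x_k ↦ x_k⁻¹` on `S_g ⧸ ⟪aᵢ⟫`;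
* `SurfaceGroup.slideEquiv k l`, `coslideEquiv k l` (`k < l`) — HANDLE SLIDES with generator
  images the words `HandleWords.slideA/B/C/D`, `coslideA/B/C/D` in `a_k, b_k, a_l, b_l` and the
  middle block `mid k l = ∏_{k<h<l}[a_h,b_h]`; they fix the block `[a_k,b_k] · mid k l · [a_l,b_l]`,
  preserve `⟪aᵢ⟫` and induce the transvections `x_k ↦ x_k x_l`, `x_l ↦ x_l x_k` on `S_g ⧸ ⟪aᵢ⟫`.
  (Found as `Inn(w) ∘ T_δ⁻¹ ∘ T_γ` with `T_γ` the twist about the band sum `γ` of the meridian `a_k`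
  and the longitude `b_l` — `b_k ↦ a_k⁻¹ b_l b_k`, `a_l ↦ a_k⁻¹ b_l a_l` — and `T_δ` the twist about
  `b_l`, then conjugated by `mid k l` for non-adjacent handles; all identities verified
  mechanically and discharged here by `group`.)
* `SurfaceGroup.cutSwapEquiv c` — `a_i ↦ a_i b_i a_i⁻¹`, `b_i ↦ a_i⁻¹` on the handles with `c i`
  (`[aba⁻¹, a⁻¹] = [a,b]`): carries the cut system `{aᵢ}` onto `{aᵢ (¬ c i), bᵢ (c i)}` up to
  conjugacy.

Only the algebra is formalised (by Dehn–Nielsen–Baer and Zieschang–Vogt–Coldewey Thm. 5.6.1 these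
automorphisms are induced by homeomorphisms of `Σ_g` extending over the handlebody; not needed).
Not here: the quotient `S_g ⧸ ⟪aᵢ⟫` and the realisation theorem (`HandlebodyGroupRealisation.lean`).

## References

* H. B. Griffiths, *Automorphisms of a 3-dimensional handlebody*, Abh. Math. Sem. Univ. Hamburg 26
  (1964) 191–210. [GriffithsHB1964Handlebody]
* H. Zieschang, *Alternierende Produkte in freien Gruppen*, Abh. Math. Sem. Univ. Hamburg 27 (1964)
  13–31. [Zieschang1964]
* H. Zieschang, E. Vogt, H.-D. Coldewey, *Surfaces and Planar Discontinuous Groups*, LNM 835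
  (1980), Ch. 5, Thm. 5.6.1. [ZieschangVogtColdewey1980]
* R. C. Lyndon, P. E. Schupp, *Combinatorial Group Theory* (2001), Ch. I §4. [LyndonSchupp2001]
-/

noncomputable section

namespace Literature.Topology.FourManifolds

open Subgroup

/-! ## The slide words (in an arbitrary group) -/

namespace HandleWords

variable {G : Type*} [Group G]

/-- Image of `a_k` under `σ_{kl}` (`A,B,C,D = a_k,b_k,a_l,b_l`, `m = mid k l`). [folklore] -/
def slideA (A D m : G) : G :=
  A * m * D⁻¹ * m⁻¹ * A * m * D * m⁻¹ * A⁻¹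

/-- Image of `b_k` under `σ_{kl}` (`A,B,C,D = a_k,b_k,a_l,b_l`, `m = mid k l`). [folklore] -/
def slideB (A B D m : G) : G :=
  A * m * D⁻¹ * m⁻¹ * A⁻¹ * m * D * m⁻¹ * B * m * D * m⁻¹ * A⁻¹

/-- Image of `a_l` under `σ_{kl}` (`A,B,C,D = a_k,b_k,a_l,b_l`, `m = mid k l`). [folklore] -/
def slideC (A C D m : G) : G :=
  m⁻¹ * A * m * D⁻¹ * m⁻¹ * A⁻¹ * m * D * C * m⁻¹ * A⁻¹ * m

/-- Image of `b_l` under `σ_{kl}` (`A,B,C,D = a_k,b_k,a_l,b_l`, `m = mid k l`). [folklore] -/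
def slideD (A D m : G) : G :=
  m⁻¹ * A * m * D * m⁻¹ * A⁻¹ * m

/-- Image of `a_k` under `σ_{kl}⁻¹` (`A,B,C,D = a_k,b_k,a_l,b_l`, `m = mid k l`). [folklore] -/
def slideInvA (A D m : G) : G :=
  m * D * m⁻¹ * A * m * D⁻¹ * m⁻¹

/-- Image of `b_k` under `σ_{kl}⁻¹` (`A,B,C,D = a_k,b_k,a_l,b_l`, `m = mid k l`). [folklore] -/
def slideInvB (A B D m : G) : G :=
  m * D * m⁻¹ * A⁻¹ * m * D⁻¹ * m⁻¹ * A * B * A * m * D⁻¹ * m⁻¹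

/-- Image of `a_l` under `σ_{kl}⁻¹` (`A,B,C,D = a_k,b_k,a_l,b_l`, `m = mid k l`). [folklore] -/
def slideInvC (A C D m : G) : G :=
  D * m⁻¹ * A⁻¹ * m * D⁻¹ * m⁻¹ * A * m * C * D * m⁻¹ * A * m * D⁻¹

/-- Image of `b_l` under `σ_{kl}⁻¹` (`A,B,C,D = a_k,b_k,a_l,b_l`, `m = mid k l`). [folklore] -/
def slideInvD (A D m : G) : G :=
  D * m⁻¹ * A⁻¹ * m * D * m⁻¹ * A * m * D⁻¹

/-- Image of `a_k` under `σ'_{kl}` (`A,B,C,D = a_k,b_k,a_l,b_l`, `m = mid k l`). [folklore] -/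
def coslideA (A B C m : G) : G :=
  A * B⁻¹ * m * C⁻¹ * m⁻¹ * B

/-- Image of `b_k` under `σ'_{kl}` (`A,B,C,D = a_k,b_k,a_l,b_l`, `m = mid k l`). [folklore] -/
def coslideB (B C m : G) : G :=
  B⁻¹ * m * C * m⁻¹ * B * m * C⁻¹ * m⁻¹ * B

/-- Image of `a_l` under `σ'_{kl}` (`A,B,C,D = a_k,b_k,a_l,b_l`, `m = mid k l`). [folklore] -/
def coslideC (B C m : G) : G :=
  m⁻¹ * B⁻¹ * m * C * m⁻¹ * B * m

/-- Image of `b_l` under `σ'_{kl}` (`A,B,C,D = a_k,b_k,a_l,b_l`, `m = mid k l`). [folklore] -/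
def coslideD (B C D m : G) : G :=
  D * C⁻¹ * m⁻¹ * B * m

/-- Image of `a_k` under `σ'_{kl}⁻¹` (`A,B,C,D = a_k,b_k,a_l,b_l`, `m = mid k l`). [folklore] -/
def coslideInvA (A C m : G) : G :=
  A * m * C * m⁻¹

/-- Image of `b_k` under `σ'_{kl}⁻¹` (`A,B,C,D = a_k,b_k,a_l,b_l`, `m = mid k l`). [folklore] -/
def coslideInvB (B C m : G) : G :=
  m * C⁻¹ * m⁻¹ * B * m * C * m⁻¹

/-- Image of `a_l` under `σ'_{kl}⁻¹` (`A,B,C,D = a_k,b_k,a_l,b_l`, `m = mid k l`). [folklore] -/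
def coslideInvC (B C m : G) : G :=
  C⁻¹ * m⁻¹ * B * m * C * m⁻¹ * B⁻¹ * m * C

/-- Image of `b_l` under `σ'_{kl}⁻¹` (`A,B,C,D = a_k,b_k,a_l,b_l`, `m = mid k l`). [folklore] -/
def coslideInvD (B C D m : G) : G :=
  D * m⁻¹ * B⁻¹ * m * C

end HandleWords

namespace SurfaceGroup

open HandleWords

variable {g : ℕ}

/-! ## The moves -/

/-- **Inversion move** of handle `k`: `a_k ↦ b_k a_k⁻¹ b_k⁻¹`, `b_k ↦ b_k a_k b_k⁻²`, identity on
the other handles; inverse `a_k ↦ [a_k,b_k] a_k⁻¹`, `b_k ↦ b_k⁻¹ a_k⁻¹`.  An automorphism of `S_g`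
fixing `[a_k, b_k]` on the nose which induces the Nielsen inversion `x_k ↦ x_k⁻¹` on
`S_g ⧸ ⟪aᵢ⟫`. [folklore] -/
def flipEquiv (k : Fin g) : SurfaceGroup g ≃* SurfaceGroup g :=
  equivOfGens
    (localGens (fun i => if i = k then b k * (a k)⁻¹ * (b k)⁻¹ else a i)
      (fun i => if i = k then b k * a k * (b k)⁻¹ * (b k)⁻¹ else b i))
    (localGens (fun i => if i = k then a k * b k * (a k)⁻¹ * (b k)⁻¹ * (a k)⁻¹ else a i)
      (fun i => if i = k then (b k)⁻¹ * (a k)⁻¹ else b i))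
    (prod_relFactor_localGens _ _ fun i => by
      by_cases hi : i = k
      · subst hi; simp only [if_true]; group
      · simp [hi])
    (prod_relFactor_localGens _ _ fun i => by
      by_cases hi : i = k
      · subst hi; simp only [if_true]; group
      · simp [hi])
    (by
      rintro ⟨i, _ | _⟩
      · by_cases hi : i = k
        · subst hi; rw [← a_def]; simp [map_mul, map_inv]; group
        · rw [← a_def]; simp [hi]
      · by_cases hi : i = k
        · subst hi; rw [← b_def]; simp [map_mul, map_inv]; group
        · rw [← b_def]; simp [hi])
    (by
      rintro ⟨i, _ | _⟩
      · by_cases hi : i = k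
        · subst hi; rw [← a_def]; simp [map_mul, map_inv]; group
        · rw [← a_def]; simp [hi]
      · by_cases hi : i = k
        · subst hi; rw [← b_def]; simp [map_mul, map_inv]; group
        · rw [← b_def]; simp [hi])

/-- `flipEquiv k` on `a_k`. [folklore] -/
theorem flipEquiv_a_self (k : Fin g) : flipEquiv k (a k) = b k * (a k)⁻¹ * (b k)⁻¹ := by
  simp [flipEquiv, a_def k]

/-- `flipEquiv k` on `b_k`. [folklore] -/
theorem flipEquiv_b_self (k : Fin g) : flipEquiv k (b k) = b k * a k * (b k)⁻¹ * (b k)⁻¹ := by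
  simp [flipEquiv, b_def k]

/-- `flipEquiv k` on `aᵢ`, `i ≠ k`. [folklore] -/
theorem flipEquiv_a_of_ne {k i : Fin g} (h : i ≠ k) : flipEquiv k (a i) = a i := by
  simp [flipEquiv, a_def i, h]

/-- `flipEquiv k` on `bᵢ`, `i ≠ k`. [folklore] -/
theorem flipEquiv_b_of_ne {k i : Fin g} (h : i ≠ k) : flipEquiv k (b i) = b i := by
  simp [flipEquiv, b_def i, h]

/-- **Cut swap**: on the handles with `c i`, `a_i ↦ a_i b_i a_i⁻¹`, `b_i ↦ a_i⁻¹`; identity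
elsewhere; inverse `a_i ↦ b_i⁻¹`, `b_i ↦ b_i a_i b_i⁻¹`.  An automorphism of `S_g` fixing every
`[aᵢ,bᵢ]` on the nose (`[aba⁻¹, a⁻¹] = [a,b]`) carrying `{aᵢ}` to `{aᵢ (¬ c i), bᵢ (c i)}` up to
conjugacy. [folklore] -/
def cutSwapEquiv (c : Fin g → Bool) : SurfaceGroup g ≃* SurfaceGroup g :=
  equivOfGens
    (localGens (fun i => if c i then a i * b i * (a i)⁻¹ else a i)
      (fun i => if c i then (a i)⁻¹ else b i))
    (localGens (fun i => if c i then (b i)⁻¹ else a i)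
      (fun i => if c i then b i * a i * (b i)⁻¹ else b i))
    (prod_relFactor_localGens _ _ fun i => by
      by_cases hi : c i
      · simp only [hi, if_true]; group
      · simp [hi])
    (prod_relFactor_localGens _ _ fun i => by
      by_cases hi : c i
      · simp only [hi, if_true]; group
      · simp [hi])
    (by
      rintro ⟨i, _ | _⟩
      · by_cases hi : c i
        · rw [← a_def]; simp [hi, map_mul, map_inv]; group
        · rw [← a_def]; simp [hi]
      · by_cases hi : c i
        · rw [← b_def]; simp [hi, map_inv]
        · rw [← b_def]; simp [hi])
    (by
      rintro ⟨i, _ | _⟩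
      · by_cases hi : c i
        · rw [← a_def]; simp [hi, map_inv]
        · rw [← a_def]; simp [hi]
      · by_cases hi : c i
        · rw [← b_def]; simp [hi, map_mul, map_inv]; group
        · rw [← b_def]; simp [hi])

/-- `cutSwapEquiv c` on `aᵢ`. [folklore] -/
theorem cutSwapEquiv_a (c : Fin g → Bool) (i : Fin g) :
    cutSwapEquiv c (a i) = if c i then a i * b i * (a i)⁻¹ else a i := by
  simp [cutSwapEquiv, a_def i]

/-- `cutSwapEquiv c` on `bᵢ`. [folklore] -/
theorem cutSwapEquiv_b (c : Fin g → Bool) (i : Fin g) :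
    cutSwapEquiv c (b i) = if c i then (a i)⁻¹ else b i := by
  simp [cutSwapEquiv, b_def i]

/-- `(cutSwapEquiv c)⁻¹` on `aᵢ`. [folklore] -/
theorem cutSwapEquiv_symm_a (c : Fin g → Bool) (i : Fin g) :
    (cutSwapEquiv c).symm (a i) = if c i then (b i)⁻¹ else a i := by
  simp [cutSwapEquiv, a_def i]

/-- `(cutSwapEquiv c)⁻¹` on `bᵢ`. [folklore] -/
theorem cutSwapEquiv_symm_b (c : Fin g → Bool) (i : Fin g) :
    (cutSwapEquiv c).symm (b i) = if c i then b i * a i * (b i)⁻¹ else b i := by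
  simp [cutSwapEquiv, b_def i]

section slides

variable {k l : Fin g} (hkl : k < l)
include hkl

/-- **Handle slide** `σ_{kl}` (`k < l`): the automorphism of `S_g` with the generator images
`HandleWords.slideA/B/C/D` on `a_k, b_k, a_l, b_l` (identity on the other handles; inverse
`slideInvA/B/C/D`), fixing the relator on the nose; it preserves `⟪aᵢ⟫` and induces the Nielsen
transvection `x_k ↦ x_k x_l` on `S_g ⧸ ⟪aᵢ⟫ = F⟨xᵢ = b̄ᵢ⟩`. [folklore] -/
def slideEquiv : SurfaceGroup g ≃* SurfaceGroup g :=
  equivOfGens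
    (blockGens k l (slideA (a k) (b l) (mid k l)) (slideB (a k) (b k) (b l) (mid k l))
      (slideC (a k) (a l) (b l) (mid k l)) (slideD (a k) (b l) (mid k l)))
    (blockGens k l (slideInvA (a k) (b l) (mid k l)) (slideInvB (a k) (b k) (b l) (mid k l))
      (slideInvC (a k) (a l) (b l) (mid k l)) (slideInvD (a k) (b l) (mid k l)))
    (prod_relFactor_blockGens hkl _ _ _ _ (by
      simp only [slideA, slideB, slideC, slideD]; group))
    (prod_relFactor_blockGens hkl _ _ _ _ (by
      simp only [slideInvA, slideInvB, slideInvC, slideInvD]; group))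
    (by
      rintro ⟨i, s⟩
      by_cases hik : i = k
      · subst hik; cases s
        · rw [← a_def]; simp [hkl, map_mul, map_inv, slideA, slideInvA, slideInvD]; group
        · rw [← b_def]; simp [hkl, map_mul, map_inv, slideB, slideInvA, slideInvB, slideInvD]
          group
      by_cases hil : i = l
      · subst hil; cases s
        · rw [← a_def]; simp [hkl, map_mul, map_inv, slideC, slideInvA, slideInvC, slideInvD]
          group
        · rw [← b_def]; simp [hkl, map_mul, map_inv, slideD, slideInvA, slideInvD]; group
      simp [blockGens_of_ne _ _ _ _ hik hil])
    (by
      rintro ⟨i, s⟩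
      by_cases hik : i = k
      · subst hik; cases s
        · rw [← a_def]; simp [hkl, map_mul, map_inv, slideInvA, slideA, slideD]; group
        · rw [← b_def]; simp [hkl, map_mul, map_inv, slideInvB, slideA, slideB, slideD]; group
      by_cases hil : i = l
      · subst hil; cases s
        · rw [← a_def]; simp [hkl, map_mul, map_inv, slideInvC, slideA, slideC, slideD]; group
        · rw [← b_def]; simp [hkl, map_mul, map_inv, slideInvD, slideA, slideD]; group
      simp [blockGens_of_ne _ _ _ _ hik hil])

/-- `σ_{kl}` on generators. [folklore] -/
theorem slideEquiv_of (p : surfaceGen g) : slideEquiv hkl (PresentedGroup.of p) =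
    blockGens k l (slideA (a k) (b l) (mid k l)) (slideB (a k) (b k) (b l) (mid k l))
      (slideC (a k) (a l) (b l) (mid k l)) (slideD (a k) (b l) (mid k l)) p := by
  simp [slideEquiv]

/-- **Handle slide** `σ'_{kl}` (`k < l`): the automorphism of `S_g` with the generator images
`HandleWords.coslideA/B/C/D` (inverse `coslideInvA/B/C/D`), fixing the relator on the nose,
preserving `⟪aᵢ⟫` and inducing the Nielsen transvection `x_l ↦ x_l x_k` on `S_g ⧸ ⟪aᵢ⟫`.
[folklore] -/
def coslideEquiv : SurfaceGroup g ≃* SurfaceGroup g :=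
  equivOfGens
    (blockGens k l (coslideA (a k) (b k) (a l) (mid k l)) (coslideB (b k) (a l) (mid k l))
      (coslideC (b k) (a l) (mid k l)) (coslideD (b k) (a l) (b l) (mid k l)))
    (blockGens k l (coslideInvA (a k) (a l) (mid k l)) (coslideInvB (b k) (a l) (mid k l))
      (coslideInvC (b k) (a l) (mid k l)) (coslideInvD (b k) (a l) (b l) (mid k l)))
    (prod_relFactor_blockGens hkl _ _ _ _ (by
      simp only [coslideA, coslideB, coslideC, coslideD]; group))
    (prod_relFactor_blockGens hkl _ _ _ _ (by
      simp only [coslideInvA, coslideInvB, coslideInvC, coslideInvD]; group))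
    (by
      rintro ⟨i, s⟩
      by_cases hik : i = k
      · subst hik; cases s
        · rw [← a_def]
          simp [hkl, map_mul, map_inv, coslideA, coslideInvA, coslideInvB, coslideInvC]
          group
        · rw [← b_def]; simp [hkl, map_mul, map_inv, coslideB, coslideInvB, coslideInvC]; group
      by_cases hil : i = l
      · subst hil; cases s
        · rw [← a_def]; simp [hkl, map_mul, map_inv, coslideC, coslideInvB, coslideInvC]; group
        · rw [← b_def]
          simp [hkl, map_mul, map_inv, coslideD, coslideInvB, coslideInvC, coslideInvD]
          group
      simp [blockGens_of_ne _ _ _ _ hik hil])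
    (by
      rintro ⟨i, s⟩
      by_cases hik : i = k
      · subst hik; cases s
        · rw [← a_def]; simp [hkl, map_mul, map_inv, coslideInvA, coslideA, coslideC]; group
        · rw [← b_def]; simp [hkl, map_mul, map_inv, coslideInvB, coslideB, coslideC]; group
      by_cases hil : i = l
      · subst hil; cases s
        · rw [← a_def]; simp [hkl, map_mul, map_inv, coslideInvC, coslideB, coslideC]; group
        · rw [← b_def]
          simp [hkl, map_mul, map_inv, coslideInvD, coslideB, coslideC, coslideD]
          group
      simp [blockGens_of_ne _ _ _ _ hik hil])

/-- `σ'_{kl}` on generators. [folklore] -/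
theorem coslideEquiv_of (p : surfaceGen g) : coslideEquiv hkl (PresentedGroup.of p) =
    blockGens k l (coslideA (a k) (b k) (a l) (mid k l)) (coslideB (b k) (a l) (mid k l))
      (coslideC (b k) (a l) (mid k l)) (coslideD (b k) (a l) (b l) (mid k l)) p := by
  simp [coslideEquiv]

end slides

end SurfaceGroup

end Literature.Topology.FourManifolds

end
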